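import Summits.CriticalPhenomena.PercolationContinuityZ3.Theorems.Transplant.KNCells2CoverO
import Summits.CriticalPhenomena.PercolationContinuityZ3.Theorems.Transplant.KNCells2Cover
import Summits.CriticalPhenomena.PercolationContinuityZ3.Theorems.Transplant.KNCellsStepsDefsO
import Summits.CriticalPhenomena.PercolationContinuityZ3.Theorems.Transplant.KNCellsStepsDefs
import Summits.CriticalPhenomena.PercolationContinuityZ3.Theorems.Transplant.KNCellsSchemeO
import Summits.CriticalPhenomena.PercolationContinuityZ3.Theorems.Transplant.KNCellsProcessO
import Summits.CriticalPhenomena.PercolationContinuityZ3.Theorems.Transplant.KNCellsRunO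
import Summits.CriticalPhenomena.PercolationContinuityZ3.Theorems.Transplant.KNCellsRunInvO
import Summits.CriticalPhenomena.PercolationContinuityZ3.Theorems.Transplant.KNCells2SchemeO
import Summits.CriticalPhenomena.PercolationContinuityZ3.Theorems.Transplant.KNCells2RunO
import Summits.CriticalPhenomena.PercolationContinuityZ3.Theorems.Transplant.KNCells2RunInvO
import Summits.CriticalPhenomena.PercolationContinuityZ3.Theorems.Transplant.KNCellsCoverO
import Summits.CriticalPhenomena.PercolationContinuityZ3.Theorems.Transplant.KNCells2FacePrefix
import Literature.Probability.Percolation.OrientedHistorySiteRenormalizationRun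
import HarnessLib

/-!
# N2 (frames-only node `SamePDropOfSkeletonFrm₁`, OPEN) — ORIENTED MACRO LAYER (WAVE 0 (c1), (R-18) `q ≡ true`): the oriented twin of N1's `KNCells2FacePrefix`

builds on p205010 (kernel theorem, internal audit signed; external expert review pending) — nothing in this file uses p205010; NOTHING is claimed about the
open node `SamePDropOfSkeletonFrm₁` (`SamePDropOfSkeletonNeg₁` is CLOSED in the tree and untouched by this file).
Status sentence (coordinator 2026-08-20T04:30Z): "θ(p_c) = 0 on ℤ^d, all d ≥ 2 — kernel-verified (Lean 4/Mathlib, standard axioms); internal adversarial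
audit SIGNED 2026-08-20 04:29Z; external expert review pending."
Lane `prim-bschramm-*`, seat `prim-bschramm-stmt` (gen 19); helper file (`--supports stmt-CriticalPhenomena-4575 --as helper`); N2-SCOPE §20, (R-18)/(R-19).
PORT RULES (HOME/prim-bschramm-stmt-g19/lean/port_orient.py): the history-site API is replaced by its ORIENTED twin at the fixed quadrant `qNE := fun _ => true`
(`HState.choice ↦ HState.ochoice qNE`, `mstOf ↦ omstOf qNE`, `mst/stN ↦ omst/ostN qNE`, `occFinal ↦ ooccFinal qNE`, `Lawful ↦ OLawful qNE`, onward directions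
`onward ↦ onwardO` = the POSITIVE ones, (N2-e)); every declaration whose text changes thereby — directly or through a changed declaration — is re-declared with the
suffix `O` (same namespace); unchanged declarations of the N1 file are NOT repeated (the N1 module is imported). Docstrings/citations are N1's.
N1 HEADER (kept for the reader):
* `Sep`, `LevelData`, `LevelGeom` (the instance-checkable level geometry: 1-Lipschitz level along edges, `Q_v` and the near corridor at levels
  `≤ ℓQ < L j`, stubs/faces as sublevel/level sets, far faces (`j+1 ≤ K`) and targets beyond, separations of `Btw`/cells/zones from `Efar`);
* `Valid₂.sep_Efar`, **`exists_face_prefix₂`**, **`reach_subset_Aface₂`**, **`Aface_subset_Aface₂`**,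
  `facePrefix₂_P1`, `facePrefix₂_P2` (the hypotheses `hP1`/`hP2` of `fail_bound₂` at the history anchors).
[cite: KozmaNitzan2024, §4 p. 31 (Step IV) — the ℤ^d model] [cite: GrimmettPercolation1999, §7.2]
-/
noncomputable section

open MeasureTheory ProbabilityTheory
open scoped ENNReal Classical

namespace Summit.CriticalPhenomena.PercolationContinuityZ3.Theorems

namespace Transplant

namespace KNCells

open Literature.Probability.Percolation Literature.Probability.LatticeModels SimpleGraph GadgetSystem ProbeHistory HSiteScheme Contour

variable {V : Type*} [DecidableEq V]

/-! ## §1 Separation, level data, the level geometry -/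

namespace KSchA

variable {A : Type*} {G : SimpleGraph V} [G.LocallyFinite] {S : KSchA V A} {FD : FaceData V A} {LD : LevelData V A}
variable (hL : LevelGeom G S.Γ FD LD) (hSt : StepsGeom S.Γ FD)
variable {h : ProbeHistory V} {e : Site 2 × MDir} (hV : S.Valid₂O G h e) {a a' : A} {du : MDir} (hdu : du ∈ S.onwardO G h (tgt e))
include hL hV hdu

/-! ## §2 The explored region is separated from `E_{v,x}` -/

/-- **After a valid history the explored region is separated from `E_{v,x}`** (any anchor): it is covered by the cells and zones of determined
macro-vertices, all `≠ v, x`. [cite: KozmaNitzan2024, §4 p. 26 ((29)), p. 31] -/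
theorem Valid₂O.sep_Efar : ((Sep G (S.Vx G h) (S.Γ.Efar a' (tgt e) du)) : Prop) := by
  intro y hy b hb
  obtain ⟨det, hv, hx, hsub⟩ := hV.cover
  have hy' := hsub (Finset.mem_coe.2 hy)
  simp only [CellGeom.Cover, Set.mem_iUnion, Set.mem_union, exists_prop, Finset.mem_coe] at hy'
  obtain ⟨u, hu, h' | ⟨δ', h'⟩⟩ := hy'
  · have huv : u ≠ tgt e := fun h'' => hv (h'' ▸ hu)
    have hux : u ≠ tgt e + stepVec du := fun h'' => hx du hdu (h'' ▸ hu)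
    exact hL.Cell_sep_Efar _ _ _ _ _ huv hux y h' b hb
  · have huv : u ≠ tgt e := fun h'' => hv (h'' ▸ hu)
    have hux : u ≠ tgt e + stepVec du := fun h'' => hx du hdu (h'' ▸ hu)
    exact hL.Zone_sep_Efar _ _ _ _ _ _ huv hux y h' b hb

/-! ## §3 Crossing the faces -/

omit [G.LocallyFinite] hV hdu in
/-- A corridor point not beyond level `L` has level `≤ L` (`ℓQ ≤ L`). [folklore] -/
theorem lev_le_of_mem_Hfull_of_not_past₂O {y : V} (hy : y ∈ FD.Hfull a' (tgt e) du) {Lv : ℤ} (hLv : LD.ℓQ ≤ Lv)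
    (hR : ¬(y ∈ S.Γ.Efar a' (tgt e) du ∧ Lv + 1 ≤ LD.lev a' (tgt e) du y)) : ((LD.lev a' (tgt e) du y ≤ Lv) : Prop) := by
  by_contra hlt
  push Not at hlt
  by_cases hyE : y ∈ S.Γ.Efar a' (tgt e) du
  · exact hR ⟨hyE, by omega⟩
  · have := hL.lev_Hfull _ _ _ y hy hyE
    omega

/-- **To reach beyond the level of `F^j` through the corridor one crosses `F^j`** (KN p. 31): an open path inside `Rgn' ⊆ E_i ∪ E_{w,v} ∪ H_{v,x}`,
using edges of `G`, from the root to a point of `E_{v,x}` of level `> L j` (`1 ≤ j ≤ K`, departure anchor admissible) has an initial segment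
inside `E_i ∪ E_{w,v} ∪ H^j_{v,x}` ending on `F^j_{v,x}`. [cite: KozmaNitzan2024, §4 p. 31 (Step IV)] -/
theorem exists_face_prefix₂O (ha' : a' ∈ S.Γ.anchSet a (tgt e)) {G' : SimpleGraph V} {Rgn' : Set V}
    (hRgn : Rgn' ⊆ ↑(S.Vx G h ∪ S.Γ.Ewv a e.1 e.2 ∪ FD.Hfull a' (tgt e) du))
    (hG : ∀ y ∈ Rgn', ∀ z ∈ Rgn', G'.Adj y z → G.Adj y z)
    {z : V} (hz : z ∈ S.Γ.Efar a' (tgt e) du) {j : ℕ} (hj1 : 1 ≤ j) (hjK : j ≤ S.Γ.K)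
    (hlev : LD.L j + 1 ≤ LD.lev a' (tgt e) du z) (hp : PathIn G' Rgn' S.Γ.root z) : ((∃ y ∈ FD.Face a' (tgt e) du j,
      PathIn G' (↑(S.Vx G h ∪ S.Γ.Ewv a e.1 e.2 ∪ S.Γ.Stub a' (tgt e) du j) : Set V) S.Γ.root y) : Prop) := by
  set v := tgt e with hv
  set Lv : ℤ := LD.L j with hLvdef
  have hQL : LD.ℓQ < Lv := hL.ℓQ_lt j hj1
  set Past : Set V := {y | y ∈ S.Γ.Efar a' v du ∧ Lv + 1 ≤ LD.lev a' v du y} with hPast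
  have hsep := Valid₂O.sep_Efar hL hV hdu (a' := a')
  have h0 : S.Γ.root ∈ Pastᶜ := fun h0 => hsep.not_mem hV.root_mem h0.1
  have hzP : z ∉ Pastᶜ := fun h' => h' ⟨hz, hlev⟩
  obtain ⟨y, b, hy, hb, hbR, hyb, hpy⟩ := hp.exit h0 hzP
  simp only [Set.mem_compl_iff, not_not] at hb
  obtain ⟨hbE, hbl⟩ := hb
  have hyR : y ∈ Rgn' := hpy.right_mem.2
  have hadj : G.Adj y b := hG y hyR b hbR hyb
  have hla : LD.lev a' v du b ≤ LD.lev a' v du y + 1 := hL.adj_le _ _ _ _ _ hadj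
  -- where is `y`?  Not explored, not in `E_{w,v}`: in the corridor, at level exactly `L j`
  have hyH : y ∈ FD.Hfull a' v du ∧ LD.lev a' v du y = Lv := by
    rcases Finset.mem_union.1 (hRgn hyR) with hy' | hy'
    · rcases Finset.mem_union.1 hy' with hy'' | hy''
      · exact absurd hadj (hsep y hy'' b hbE).2
      · rcases Finset.mem_union.1 hy'' with hy3 | hy3
        · -- `y ∈ Btw a w δw`: separated from `E_{v,x}`
          have := hL.Btw_sep_Efar a a' e.1 e.2 du (du_ne_rev₂O hV hdu)
          exact absurd hadj (this y hy3 b hbE).2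
        · -- `y ∈ Q_v`: level `≤ ℓQ`, but `b` has level `≥ L j + 1 ≥ ℓQ + 2`
          exfalso
          have := hL.lev_Q _ _ _ du ha' y hy3
          omega
    · have hyl : LD.lev a' v du y ≤ Lv := lev_le_of_mem_Hfull_of_not_past₂O hL hy' hQL.le hy
      exact ⟨hy', le_antisymm hyl (by omega)⟩
  obtain ⟨hyHf, hyL⟩ := hyH
  refine ⟨y, hL.mem_Face _ _ _ _ hj1 hjK y hyHf hyL, hpy.mono ?_⟩
  -- the complement of `Past` inside `Rgn'` lies in `E_i ∪ E_{w,v} ∪ H^j`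
  rintro y' ⟨hyP, hyR'⟩
  rcases Finset.mem_union.1 (hRgn hyR') with hy' | hy'
  · exact Finset.mem_coe.2 (Finset.mem_union_left _ hy')
  · have hyl : LD.lev a' v du y' ≤ Lv := lev_le_of_mem_Hfull_of_not_past₂O hL hy' hQL.le hyP
    exact Finset.mem_coe.2 (Finset.mem_union_right _ (hL.mem_Stub _ _ _ _ hj1 hjK y' hy' hyl))

omit [G.LocallyFinite] hL hV hdu in
/-- On a lattice-only configuration the open edges inside the region are edges of `G`. [folklore] -/
theorem adj_of_lattOnly₂O {D : Finset V} {ω : BondConfig V} (hω : ω ∈ KNLevels.lattOnly G D) : ((∀ y ∈ (↑D : Set V), ∀ z ∈ (↑D : Set V), (openGraph ω).Adj y z → G.Adj y z) : Prop) := by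
  intro y hy z hz hadj
  rw [openGraph_adj] at hadj
  have hmem : s(y, z) ∈ KNLevels.pairsF D := by
    rw [← Finset.mem_coe, KNLevels.coe_pairsF]
    exact mk_mem_wireSet_iff.2 ⟨hy, hz, hadj.2⟩
  exact (SimpleGraph.mem_edgeSet _).1 (hω s(y, z) hmem hadj.1)

/-- **`Reach ⊆ A'_{K-1}`** on lattice-only configurations (hypothesis `hP1` of `fail_boundO`). [cite: KozmaNitzan2024, §4 p. 31 (Step IV)] -/
theorem reach_subset_Aface₂O (ha' : a' ∈ S.Γ.anchSet a (tgt e)) {ω : BondConfig V}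
    (hω : ω ∈ KNLevels.lattOnly G (S.Vx G h ∪ S.Γ.Ewv a e.1 e.2 ∪ FD.Hfull a' (tgt e) du))
    (hR : ω ∈ S.Reach G FD h e a a' du) : ((ω ∈ S.Aface G FD h e a a' du (S.Γ.K - 1)) : Prop) := by
  have hK1 : 1 ≤ S.Γ.K := S.Γ.hK
  have hKK : S.Γ.K - 1 + 1 = S.Γ.K := by omega
  simp only [Reach, Set.mem_iUnion, exists_prop, Finset.mem_coe] at hR
  obtain ⟨t, ht, hpath⟩ := hR
  rw [DCT16.mem_openConnIn_iff_pathIn] at hpath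
  obtain ⟨htE, htl⟩ := hL.M_far _ _ _ t ht
  obtain ⟨y, hy, hpy⟩ := exists_face_prefix₂O hL hV hdu ha' subset_rfl (adj_of_lattOnly₂O hω) htE hK1 le_rfl htl hpath
  simp only [Aface, Set.mem_iUnion, exists_prop, Finset.mem_coe, hKK]
  exact ⟨y, hy, DCT16.mem_openConnIn_iff_pathIn.2 hpy⟩

include hSt in
/-- **`A'_j ⊆ A'_{j-1}`** (`1 ≤ j < K`) on lattice-only configurations (hypothesis `hP2` of `fail_boundO`). [cite: KozmaNitzan2024, §4 p. 31 (Step IV)] -/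
theorem Aface_subset_Aface₂O (ha' : a' ∈ S.Γ.anchSet a (tgt e)) {j : ℕ} (hj1 : 1 ≤ j) (hjK : j < S.Γ.K) {ω : BondConfig V}
    (hω : ω ∈ KNLevels.lattOnly G (S.Vx G h ∪ S.Γ.Ewv a e.1 e.2 ∪ S.Γ.Stub a' (tgt e) du (j + 1)))
    (hR : ω ∈ S.Aface G FD h e a a' du j) : ((ω ∈ S.Aface G FD h e a a' du (j - 1)) : Prop) := by
  have hjj : j - 1 + 1 = j := by omega
  simp only [Aface, Set.mem_iUnion, exists_prop, Finset.mem_coe] at hR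
  obtain ⟨t, ht, hpath⟩ := hR
  rw [DCT16.mem_openConnIn_iff_pathIn] at hpath
  have hsub : (↑(S.Vx G h ∪ S.Γ.Ewv a e.1 e.2 ∪ S.Γ.Stub a' (tgt e) du (j + 1)) : Set V) ⊆
      ↑(S.Vx G h ∪ S.Γ.Ewv a e.1 e.2 ∪ FD.Hfull a' (tgt e) du) :=
    Finset.coe_subset.2 (Finset.union_subset_union le_rfl (hSt.Stub_subset_Hfull _ _ _ _ (by omega)))
  obtain ⟨htE, htl⟩ := hL.Face_far _ _ _ j (by omega) t ht
  obtain ⟨y, hy, hpy⟩ := exists_face_prefix₂O hL hV hdu ha' hsub (adj_of_lattOnly₂O hω) htE hj1 hjK.le htl hpath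
  simp only [Aface, Set.mem_iUnion, exists_prop, Finset.mem_coe, hjj]
  exact ⟨y, hy, DCT16.mem_openConnIn_iff_pathIn.2 hpy⟩

omit hV hdu in
/-- `hP1` of `fail_bound₂O` at the history anchors `(α, β) = (arr v, dep v)`, discharged by a level geometry. [cite: KozmaNitzan2024, §4 p. 31 (Step IV)] -/
theorem facePrefix₂_P1O {h : ProbeHistory V} {e : Site 2 × MDir} (hV : S.Valid₂O G h e) :
    ∀ du ∈ S.onwardO G h (tgt e), ∀ ω,
    ω ∈ KNLevels.lattOnly G (S.Vx G h ∪ S.Γ.Ewv (S.aOf₁O G h e) e.1 e.2 ∪ FD.Hfull (S.aOf₂O G h e) (tgt e) du) →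
    ω ∈ S.Reach G FD h e (S.aOf₁O G h e) (S.aOf₂O G h e) du → ω ∈ S.Aface G FD h e (S.aOf₁O G h e) (S.aOf₂O G h e) du (S.Γ.K - 1) :=
  fun _ hdu _ hω hR => reach_subset_Aface₂O hL hV hdu hV.anch hω hR

omit hV hdu in
include hSt in
/-- `hP2` of `fail_bound₂O` at the history anchors, discharged by a level geometry. [cite: KozmaNitzan2024, §4 p. 31 (Step IV)] -/
theorem facePrefix₂_P2O {h : ProbeHistory V} {e : Site 2 × MDir} (hV : S.Valid₂O G h e) :
    ∀ du ∈ S.onwardO G h (tgt e), ∀ ω j,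
    1 ≤ j → j < S.Γ.K → ω ∈ KNLevels.lattOnly G (S.Vx G h ∪ S.Γ.Ewv (S.aOf₁O G h e) e.1 e.2 ∪ S.Γ.Stub (S.aOf₂O G h e) (tgt e) du (j + 1)) →
    ω ∈ S.Aface G FD h e (S.aOf₁O G h e) (S.aOf₂O G h e) du j → ω ∈ S.Aface G FD h e (S.aOf₁O G h e) (S.aOf₂O G h e) du (j - 1) :=
  fun _ hdu _ _ hj1 hjK hω hR => Aface_subset_Aface₂O hL hSt hV hdu hV.anch hj1 hjK hω hR

end KSchA

end KNCells

end Transplant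

end Summit.CriticalPhenomena.PercolationContinuityZ3.Theorems

end
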